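import Summits.Ventures.PercRepro.Night2FatZThreeB
import Summits.Ventures.PercRepro.Night2FatDegSingle

import Summits.Ventures.PercRepro.Night2FatDegWitnessF1
import Summits.Ventures.PercRepro.Night2FatDegWitnessF2
import Summits.Ventures.PercRepro.Night2FatDegWitnessF3
import Summits.Ventures.PercRepro.Night2FatDegWitnessC1
import Summits.Ventures.PercRepro.Night2FatDegWitnessC2
import Summits.Ventures.PercRepro.Night2FatDegWitnessC3
import Summits.Ventures.PercRepro.Night2FatDegWitnessC4
import Summits.Ventures.PercRepro.Night2FatDegWitnessC5

/-!
# night-2: the witnesses of the singly degenerate regime at small `N` — side points, free points, unloaded singletons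

**`exists_small_witnesses_deg`**: for every lossy basis pair of the singly degenerate regime there are sets `U` of side
points, `V` of free points and `E` of points on no non-class basis line (unloaded singletons) of `W ∖ {x}` in one of
four patterns: (α) the line of `M` is not a non-class basis line, `|U| = 2`, `|V| = 1`, `|E| ≥ 2`;
(β) `|U| = 1`, `|V| = 3`, `|E| ≥ 2`; (γ) `|U| = 2`, `|V| = 2`, `|E| ≥ 1`; (δ) `|U| = 1`, `|V| = 2`, `|E| ≥ 3`.
Each pattern gives the fair share at `N = 6, 7, 8` (`Night2FatDegNumIccA/B`).  The case analysis follows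
`exists_side_and_free_deg`: `|P₂| ∈ {0, 1, 2, 3}` basis points of `π₂` off the spine.
Paper `proofs/NIGHT-2-g35.md` §5.
-/

namespace PercRepro.Shadow

open PercRepro.ThmH PercRepro.PerFlat

variable {α : Type*} [DecidableEq α] {M : Matroid α} [M.Finite] {G : Finset α}

/-- **The small-`N` witnesses** (see the module docstring). -/
theorem exists_small_witnesses_deg (hG : G ∈ flatsQ M (5 + 1)) (hd : (gr M \ G).card = 2)
    (hk : kColoops M G = 1) (hs : ∀ e ∈ gr M, ∀ f ∈ gr M, e ≠ f → rkN M {e, f} = 2)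
    (hfat : (fatClosures M 5 G 2).card ≤ 1) {B₀ : Finset α}
    (hB₀ : B₀ ∈ thinMembers M 5 G) {w₀ x : α} (hD : G \ clF M B₀ = {w₀, x}) (hne : w₀ ≠ x) {R₁ : Finset α}
    (hR₁V : R₁ ⊆ (G \ coloops M G) \ {w₀, x}) (hR₁2 : rkN M R₁ = 2) (hR₁3 : 3 ≤ R₁.card)
    (hcop : rkN M (insert w₀ (insert x R₁)) ≤ 3) {c₂ c₃ : α}
    (hc₂V : c₂ ∈ (G \ coloops M G) \ {w₀, x}) (hc₃V : c₃ ∈ (G \ coloops M G) \ {w₀, x})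
    (hc₂ : c₂ ∉ clF M R₁) (hc₃ : c₃ ∉ clF M (insert c₂ R₁))
    (hcover : ∀ e ∈ (G \ coloops M G) \ {w₀, x}, e ∈ clF M (insert c₂ R₁) ∨ e ∈ clF M (insert c₃ R₁))
    (hnd₂ : 3 ≤ rkN M (((G \ coloops M G) \ {w₀, x}).filter
      (fun e => e ∈ clF M (insert c₂ R₁) ∧ e ∉ clF M R₁)))
    (hdeg₃ : rkN M (((G \ coloops M G) \ {w₀, x}).filter
      (fun e => e ∈ clF M (insert c₃ R₁) ∧ e ∉ clF M R₁)) ≤ 2)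
    {B : Finset α} (hB : B ∈ thinMembers M 5 G) (hnP : ¬ bigP M G B) {z : α} (hz : z ∈ G \ clF M B)
    (hw₀ : w₀ ∈ insert z B) (hx : x ∉ insert z B) :
    ∃ U V E : Finset α, U ⊆ (G \ insert z B).erase x ∧ (∀ y ∈ U, y ∈ clF M (insert c₃ R₁) ∧ y ∉ clF M R₁) ∧
      V ⊆ (G \ insert z B).erase x ∧
      (∀ f ∈ V, f ∉ clF M (((G \ coloops M G) \ {w₀, x}).filter (fun e => e ∈ clF M (insert c₃ R₁) ∧ e ∉ clF M R₁)) ∧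
        ∀ a ∈ (insert z B \ coloops M G).erase w₀, ∀ b ∈ (insert z B \ coloops M G).erase w₀, a ≠ b →
          f ∈ clF M {a, b} → rkN M (insert w₀ (insert x {a, b})) ≤ 3 →
          4 ≤ rkN M ({a, b} ∪ (((G \ coloops M G) \ {w₀, x}).filter (fun e => e ∈ clF M (insert c₃ R₁) ∧ e ∉ clF M R₁)))) ∧
      E ⊆ (G \ insert z B).erase x ∧
      (∀ y ∈ E, ∀ a ∈ (insert z B \ coloops M G).erase w₀, ∀ b ∈ (insert z B \ coloops M G).erase w₀, a ≠ b →
        y ∈ clF M {a, b} → rkN M (insert w₀ (insert x {a, b})) ≤ 3) ∧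
      ((¬ (4 ≤ rkN M (insert w₀ (insert x (((G \ coloops M G) \ {w₀, x}).filter (fun e => e ∈ clF M (insert c₃ R₁) ∧ e ∉ clF M R₁)))) ∧
          ∃ a ∈ (insert z B \ coloops M G).erase w₀, ∃ b ∈ (insert z B \ coloops M G).erase w₀, a ≠ b ∧
            a ∈ clF M (((G \ coloops M G) \ {w₀, x}).filter (fun e => e ∈ clF M (insert c₃ R₁) ∧ e ∉ clF M R₁)) ∧ b ∈ clF M (((G \ coloops M G) \ {w₀, x}).filter (fun e => e ∈ clF M (insert c₃ R₁) ∧ e ∉ clF M R₁))) ∧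
          U.card = 2 ∧ V.card = 1 ∧ 2 ≤ E.card) ∨
        (U.card = 1 ∧ V.card = 3 ∧ 2 ≤ E.card) ∨
        (U.card = 2 ∧ V.card = 2 ∧ 1 ≤ E.card) ∨
        (U.card = 1 ∧ V.card = 2 ∧ 3 ≤ E.card)) := by
  -- basic facts
  have hGg : G ⊆ gr M := (mem_flatsQ.1 hG).1
  set V := (G \ coloops M G) \ {w₀, x} with hV
  have hVg : V ⊆ gr M := fun e he => hGg (Finset.mem_sdiff.1 (Finset.mem_sdiff.1 he).1).1
  set P := (insert z B \ coloops M G).erase w₀ with hP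
  set W := (G \ insert z B).erase x with hW
  have hPV : P ⊆ V := basis_points_subset_V hB hz hx
  have hWV : W ⊆ V := W_subset_V hG hd hB hw₀
  have hPW : ∀ e ∈ P, e ∉ W := fun e he => basis_point_notMem_W he
  have hPind : M.Indep (P : Set α) := basis_points_indep hG hd hk hB hnP hz
  have hP4 : P.card = 4 := card_basis_points hG hd hk hB₀ hD hB hnP hz hw₀
  have hw₀g : w₀ ∈ gr M := by
    have : w₀ ∈ G \ clF M B₀ := by rw [hD]; exact Finset.mem_insert_self _ _
    exact hGg (Finset.mem_sdiff.1 this).1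
  have hxg : x ∈ gr M := by
    have : x ∈ G \ clF M B₀ := by rw [hD]; exact Finset.mem_insert_of_mem (Finset.mem_singleton_self _)
    exact hGg (Finset.mem_sdiff.1 this).1
  have hw₀V : w₀ ∉ clF M V := w₀_notMem_clF_V hD
  have hR₁g : R₁ ⊆ gr M := hR₁V.trans hVg
  have hc₂g : c₂ ∈ gr M := hVg hc₂V
  have hc₃g : c₃ ∈ gr M := hVg hc₃V
  have hc₃L : c₃ ∉ clF M R₁ := fun h => hc₃ (clF_mono (Finset.subset_insert _ _) h)
  have hPorW : ∀ e ∈ V, e ∈ P ∨ e ∈ W := fun e he => mem_basis_or_W_of_mem_V he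
  set Mset := V.filter (fun e => e ∈ clF M (insert c₃ R₁) ∧ e ∉ clF M R₁) with hMset
  have hMg : Mset ⊆ gr M := (Finset.filter_subset _ _).trans hVg
  have hM3 : 3 ≤ Mset.card := three_le_card_side_of_fat hG hd hk hs hfat hB₀ hD hne hR₁V hR₁2 hR₁3 hcop hc₂V hc₃V
    hc₂ hc₃ hcover
  have hM2 : 1 < Mset.card := by omega
  have hMne : Mset.Nonempty := Finset.card_pos.1 (by omega)
  -- the basis points on the side line
  set P₃ := P.filter (fun e => e ∈ Mset) with hP₃
  have hP₃2 : P₃.card ≤ 2 := by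
    have hsub : P₃ ⊆ P.filter (fun e => e ∈ clF M Mset) := by
      intro e he
      rw [hP₃, Finset.mem_filter] at he
      exact Finset.mem_filter.2 ⟨he.1, subset_clF_of_subset_gr hMg he.2⟩
    exact (Finset.card_le_card hsub).trans (card_filter_clF_le_two_of_indep hPind hdeg₃)
  -- the side points of `W`
  set M' := W.filter (fun e => e ∈ Mset) with hM'
  have hMsplit : Mset.card = P₃.card + M'.card :=
    deg_wit_msplit hd hk hfat hR₁2 hR₁3 hcop hnd₂ hdeg₃ hV hP hW hMset hP₃ hM' hPW hP4 hPorW hM3 hM2 hP₃2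
  have hM'1 : 1 ≤ M'.card := by omega
  obtain ⟨y₃, hy₃⟩ := Finset.card_pos.1 (by omega : 0 < M'.card)
  rw [hM', Finset.mem_filter] at hy₃
  have hy₃side : y₃ ∈ clF M (insert c₃ R₁) ∧ y₃ ∉ clF M R₁ := (Finset.mem_filter.1 hy₃.2).2
  -- the basis points on the spine and in `π₂` off the spine
  set L₀ := P.filter (fun e => e ∈ clF M R₁) with hL₀
  set P₂ := P.filter (fun e => e ∈ clF M (insert c₂ R₁) ∧ e ∉ clF M R₁) with hP₂
  have hL₀2 : L₀.card ≤ 2 := by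
    have := card_filter_clF_le_rkN_of_indep (X := R₁) hPind
    rw [hR₁2] at this
    exact this
  have hπ₂3 : (P.filter (fun e => e ∈ clF M (insert c₂ R₁))).card ≤ 3 := by
    have := card_filter_clF_le_rkN_of_indep (X := insert c₂ R₁) hPind
    rw [rkN_insert_of_notMem_clF hc₂g hc₂, hR₁2] at this
    exact this
  have hL₀P₂ : L₀.card + P₂.card ≤ 3 :=
    deg_wit_l0p2 hd hk hfat hR₁2 hR₁3 hcop hnd₂ hdeg₃ hV hP hW hMset hP₃ hM' hL₀ hP₂ hP4 hM3 hM2 hP₃2 hMsplit hM'1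
        hL₀2 hπ₂3
  have hsplit : L₀.card + P₂.card + P₃.card = 4 :=
    deg_wit_split hd hk hfat hR₁2 hR₁3 hcop hc₂ hc₃ hcover hnd₂ hdeg₃ hV hP hW hMset hP₃ hM' hL₀ hP₂ hPV hP4 hR₁g
        hc₂g hc₃g hM3 hM2 hP₃2 hMsplit hM'1 hL₀2 hπ₂3 hL₀P₂
  -- the points of `π₂` off the spine
  set Aset := V.filter (fun e => e ∈ clF M (insert c₂ R₁) ∧ e ∉ clF M R₁) with hAset
  have hAg : Aset ⊆ gr M := (Finset.filter_subset _ _).trans hVg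
  have hAW : ∀ e ∈ Aset, e ∉ P₂ → e ∈ W := by
    intro e he heP
    rcases hPorW e (Finset.mem_filter.1 he).1 with h | h
    · exact absurd (Finset.mem_filter.2 ⟨h, (Finset.mem_filter.1 he).2⟩) heP
    · exact h
  -- the spine points
  set Lset := V.filter (fun e => e ∈ clF M R₁) with hLset
  have hL3 : 3 ≤ Lset.card := by
    have hsub : R₁ ⊆ Lset := fun e he => Finset.mem_filter.2 ⟨hR₁V he, subset_clF_of_subset_gr hR₁g he⟩
    exact hR₁3.trans (Finset.card_le_card hsub)
  have hLW : ∀ e ∈ Lset, e ∉ L₀ → e ∈ W := by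
    intro e he heP
    rcases hPorW e (Finset.mem_filter.1 he).1 with h | h
    · exact absurd (Finset.mem_filter.2 ⟨h, (Finset.mem_filter.1 he).2⟩) heP
    · exact h
  -- the spine points of `W` off `clF M`: at most one spine point lies in `clF M`
  have hLM : ∀ s ∈ Lset, ∀ s' ∈ Lset, s ≠ s' → s ∈ clF M Mset → s' ∉ clF M Mset := by
    intro s hs₁ s' hs' hss' hsM hs'M
    exact hss' (eq_of_mem_spine_of_mem_clF_side hs hVg hR₁g hR₁2 hdeg₃ hMne (hVg (Finset.mem_filter.1 hs₁).1)
      (hVg (Finset.mem_filter.1 hs').1) (Finset.mem_filter.1 hs₁).2 (Finset.mem_filter.1 hs').2 hsM hs'M)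
  -- a point of `π₂` off the spine is off `clF M`
  have hAM : ∀ e ∈ Aset, e ∉ clF M Mset := fun e he =>
    notMem_clF_side_of_plane_two hR₁g hc₂g hc₃g hc₂ hc₃ (Finset.mem_filter.1 he).2.1 (Finset.mem_filter.1 he).2.2
  -- at most one class basis line through a basis point off the spine
  have hpencil : ∀ c ∈ P₂, ∀ a ∈ P, ∀ b ∈ P, c ≠ a → c ≠ b → a ≠ b →
      rkN M (insert w₀ (insert x {c, a})) ≤ 3 → rkN M (insert w₀ (insert x {c, b})) ≤ 3 → False := by
    intro c hc a ha b hb hca hcb hab h1 h2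
    exact no_two_class_lines_through_off hs hVg hw₀g hxg hne hw₀V hR₁V hR₁2 hcop hPV hPind
      (Finset.mem_filter.1 hc).1 ha hb hca hcb hab (Finset.mem_filter.1 hc).2.2 h1 h2
  -- a spine–off basis pair coplanar with `M` has its spine point in `clF M`
  have hspineM : ∀ a ∈ L₀, ∀ c ∈ P₂, rkN M ({a, c} ∪ Mset) ≤ 3 → a ∈ clF M Mset :=
    deg_wit_spineM hd hk hs hfat hR₁2 hR₁3 hcop hc₂ hc₃ hnd₂ hdeg₃ hV hP hW hMset hP₃ hM' hL₀ hP₂ hAset hLset hVg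
        hPV hP4 hR₁g hc₂g hc₃g hc₃L hM3 hM2 hP₃2 hMsplit hM'1 hL₀2 hπ₂3 hL₀P₂ hsplit hL3
  -- two side points when `|P₃| ≤ 1`
  have htwo : P₃.card ≤ 1 → ∃ y₃' ∈ W, y₃' ≠ y₃ ∧ (y₃' ∈ clF M (insert c₃ R₁) ∧ y₃' ∉ clF M R₁) :=
    deg_wit_two hd hk hfat hR₁2 hR₁3 hcop hnd₂ hdeg₃ hV hP hW hMset hP₃ hM' hL₀ hP₂ hAset hLset hP4 hM3 hM2 hP₃2
        hMsplit hM'1 hL₀2 hπ₂3 hL₀P₂ hsplit hL3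
  -- FREE predicate helpers: a free spine point off any class basis line of `π₂ ∖ L`
  have hfreeL : L₀.card ≤ 1 → ∀ s ∈ W, s ∈ clF M R₁ → s ∉ clF M Mset → (∀ c ∈ P₂, ∀ c' ∈ P₂, c ≠ c' → s ∈ clF M
      {c, c'} → rkN M (insert w₀ (insert x {c, c'})) ≤ 3 → 4 ≤ rkN M ({c, c'} ∪ Mset)) → s ∉ clF M Mset ∧ ∀ a ∈
      P, ∀ b ∈ P, a ≠ b → s ∈ clF M {a, b} → rkN M (insert w₀ (insert x {a, b})) ≤ 3 → 4 ≤ rkN M ({a, b} ∪ Mset)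
      :=
    deg_wit_freeL hd hk hs hfat hR₁V hR₁2 hR₁3 hcop hc₂V hc₃V hc₂ hc₃ hcover hnd₂ hdeg₃ hV hP hW hMset hP₃ hM' hL₀
        hP₂ hAset hLset hVg hPV hWV hPW hP4 hM3 hM2 hP₃2 hMsplit hM'1 hL₀2 hπ₂3 hL₀P₂ hsplit hL3
  -- a free point of `π₂` off the spine
  have hfreeA : ∀ f ∈ Aset, f ∈ W → (∀ a ∈ L₀, ∀ c ∈ P₂, a ≠ c → f ∈ clF M {a, c} → rkN M (insert w₀ (insert x
      {a, c})) ≤ 3 → 4 ≤ rkN M ({a, c} ∪ Mset)) → (∀ c ∈ P₂, ∀ c' ∈ P₂, c ≠ c' → f ∈ clF M {c, c'} → rkN M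
      (insert w₀ (insert x {c, c'})) ≤ 3 → 4 ≤ rkN M ({c, c'} ∪ Mset)) → f ∉ clF M Mset ∧ ∀ a ∈ P, ∀ b ∈ P, a ≠
      b → f ∈ clF M {a, b} → rkN M (insert w₀ (insert x {a, b})) ≤ 3 → 4 ≤ rkN M ({a, b} ∪ Mset) :=
    deg_wit_freeA hd hk hs hfat hR₁V hR₁2 hR₁3 hcop hc₂V hc₃V hc₂ hc₃ hcover hnd₂ hdeg₃ hV hP hW hMset hP₃ hM' hL₀
        hP₂ hAset hLset hVg hPV hWV hPW hP4 hM3 hM2 hP₃2 hMsplit hM'1 hL₀2 hπ₂3 hL₀P₂ hsplit hL3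
  -- `Aset` has rank `≥ 3`: a point off any line
  have hAoff : ∀ X : Finset α, rkN M X ≤ 2 → ∃ f ∈ Aset, f ∉ clF M X := fun X hX =>
    exists_mem_notMem_clF_of_three_le_rkN hnd₂ hX
  have hA3 : 3 ≤ Aset.card := hnd₂.trans (rkN_le_card _)
  -- the SING criteria (points on no non-class basis line)
  have hsingA : ∀ f ∈ Aset, f ∈ W → (∀ a ∈ L₀, ∀ c ∈ P₂, a ≠ c → f ∈ clF M {a, c} → rkN M (insert w₀ (insert x
      {a, c})) ≤ 3) → (∀ c ∈ P₂, ∀ c' ∈ P₂, c ≠ c' → f ∈ clF M {c, c'} → rkN M (insert w₀ (insert x {c, c'})) ≤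
      3) → ∀ a ∈ P, ∀ b ∈ P, a ≠ b → f ∈ clF M {a, b} → rkN M (insert w₀ (insert x {a, b})) ≤ 3 :=
    deg_wit_singA hd hk hs hfat hR₁V hR₁2 hR₁3 hcop hc₂V hc₃V hc₂ hc₃ hcover hnd₂ hdeg₃ hV hP hW hMset hP₃ hM' hL₀
        hP₂ hAset hLset hVg hPV hWV hPW hP4 hM3 hM2 hP₃2 hMsplit hM'1 hL₀2 hπ₂3 hL₀P₂ hsplit hL3 hA3
  have hsingL : ∀ s ∈ W, s ∈ clF M R₁ → s ∉ clF M Mset → (∀ c ∈ P₂, ∀ c' ∈ P₂, c ≠ c' → s ∈ clF M {c, c'} → rkN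
      M (insert w₀ (insert x {c, c'})) ≤ 3) → ∀ a ∈ P, ∀ b ∈ P, a ≠ b → s ∈ clF M {a, b} → rkN M (insert w₀
      (insert x {a, b})) ≤ 3 :=
    deg_wit_singL hd hk hs hfat hR₁V hR₁2 hR₁3 hcop hc₂V hc₃V hc₂ hc₃ hcover hnd₂ hdeg₃ hV hP hW hMset hP₃ hM' hL₀
        hP₂ hAset hLset hVg hPV hWV hPW hP4 hw₀g hxg hM3 hM2 hP₃2 hMsplit hM'1 hL₀2 hπ₂3 hL₀P₂ hsplit hL3 hA3
  have hsingM : (¬ (4 ≤ rkN M (insert w₀ (insert x Mset)) ∧ ∃ a ∈ P, ∃ b ∈ P, a ≠ b ∧ a ∈ clF M Mset ∧ b ∈ clF M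
      Mset)) → ∀ y ∈ W, (y ∈ clF M (insert c₃ R₁) ∧ y ∉ clF M R₁) → ∀ a ∈ P, ∀ b ∈ P, a ≠ b → y ∈ clF M {a, b} →
      rkN M (insert w₀ (insert x {a, b})) ≤ 3 :=
    deg_wit_singM hd hk hs hfat hR₁V hR₁2 hR₁3 hcop hc₂V hc₃V hc₂ hc₃ hcover hnd₂ hdeg₃ hV hP hW hMset hP₃ hM' hL₀
        hP₂ hAset hLset hVg hPV hWV hPW hP4 hw₀g hxg hM3 hM2 hP₃2 hMsplit hM'1 hL₀2 hπ₂3 hL₀P₂ hsplit hL3 hA3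
  -- the pencil point makes the line of `M` a class line: `¬ NCL` forces the spine basis point in `clF M` off the
  -- pencil, hence `{a, c}` non-class for every `c ∈ P₂`
  have hnotcls : (4 ≤ rkN M (insert w₀ (insert x Mset))) → ∀ a ∈ L₀, a ∈ clF M Mset → ∀ c ∈ P₂, ¬ rkN M (insert
      w₀ (insert x {a, c})) ≤ 3 :=
    deg_wit_notcls hd hk hs hfat hne hR₁V hR₁2 hR₁3 hcop hnd₂ hdeg₃ hV hP hW hMset hP₃ hM' hL₀ hP₂ hAset hLset hVg
        hPV hP4 hw₀g hxg hw₀V hR₁g hMg hM3 hM2 hP₃2 hMsplit hM'1 hL₀2 hπ₂3 hL₀P₂ hsplit hL3 hA3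
  -- THE CASES on `|P₂|`
  rcases Nat.lt_or_ge P₂.card 1 with hP₂0 | hP₂1
  · -- `P₂ = ∅`: three points of `π₂` off the spine, all free and on no basis line — pattern (β)
    exact deg_wit_case_p2_empty hd hk hfat hR₁2 hR₁3 hcop hnd₂ hdeg₃ hV hP hW hMset hP₃ hM' hL₀ hP₂ hAset hLset hP4 hM3
          hM2 hP₃2 hMsplit hM'1 hy₃ hy₃side hL₀2 hπ₂3 hL₀P₂ hsplit hAW hL3 hfreeA hA3 hsingA hP₂0
  rcases Nat.lt_or_ge P₂.card 2 with hP₂1' | hP₂2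
  · -- `P₂ = {c}`
    obtain ⟨c, hcP₂⟩ := Finset.card_eq_one.1 (by omega : P₂.card = 1)
    have hcmem : c ∈ P₂ := by rw [hcP₂]; exact Finset.mem_singleton_self c
    have hcP : c ∈ P := (Finset.mem_filter.1 hcmem).1
    have hcg : c ∈ gr M := hVg (hPV hcP)
    have honly : ∀ c' ∈ P₂, c' = c := fun c' hc' => by rw [hcP₂, Finset.mem_singleton] at hc'; exact hc'
    have hccvac : ∀ t : α, ∀ c' ∈ P₂, ∀ c'' ∈ P₂, c' ≠ c'' → t ∈ clF M {c', c''} →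
        rkN M (insert w₀ (insert x {c', c''})) ≤ 3 := by
      intro t c' hc' c'' hc'' hne' _
      exact absurd ((honly c' hc').trans (honly c'' hc'').symm) hne'
    have hccvac' : ∀ t : α, ∀ c' ∈ P₂, ∀ c'' ∈ P₂, c' ≠ c'' → t ∈ clF M {c', c''} →
        rkN M (insert w₀ (insert x {c', c''})) ≤ 3 → 4 ≤ rkN M ({c', c''} ∪ Mset) := by
      intro t c' hc' c'' hc'' hne' _ _
      exact absurd ((honly c' hc').trans (honly c'' hc'').symm) hne'
    -- the points of `π₂` off the spine in `W`: at least two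
    have hA2 : 1 < (Aset.filter (fun e => e ∈ W)).card := by
      have hsplitA : Aset.card = (Aset.filter (fun e => e ∈ W)).card + (Aset.filter (fun e => ¬ e ∈ W)).card :=
        (Finset.card_filter_add_card_filter_not (s := Aset) _).symm
      have hsub : Aset.filter (fun e => ¬ e ∈ W) ⊆ P₂ := by
        intro e he
        rw [Finset.mem_filter] at he
        by_contra heP₂
        exact he.2 (hAW e he.1 heP₂)
      have := Finset.card_le_card hsub
      omega
    -- the spine points of `W`
    have hLWcard : Lset.card ≤ (Lset.filter (fun e => e ∈ W)).card + L₀.card := by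
      have hsplitL : Lset.card = (Lset.filter (fun e => e ∈ W)).card + (Lset.filter (fun e => ¬ e ∈ W)).card :=
        (Finset.card_filter_add_card_filter_not (s := Lset) _).symm
      have hsub : Lset.filter (fun e => ¬ e ∈ W) ⊆ L₀ := by
        intro e he
        rw [Finset.mem_filter] at he
        by_contra heL₀
        exact he.2 (hLW e he.1 heL₀)
      have := Finset.card_le_card hsub
      omega
    rcases Nat.lt_or_ge P₃.card 2 with hP₃1 | hP₃2
    · -- `|P₃| = 1`, `|L₀| = 2`: two side points
      exact deg_wit_case_p2_one_p3_one hd hk hs hfat hR₁2 hR₁3 hcop hcover hnd₂ hdeg₃ hV hP hW hMset hP₃ hM' hL₀ hP₂ hAset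
            hLset hVg hPV hPW hP4 hR₁g hM3 hM2 hMne hP₃2 hMsplit hM'1 hy₃ hy₃side hL₀2 hπ₂3 hL₀P₂ hsplit hAW hL3 hLM
            hAM hspineM htwo hfreeA hAoff hA3 hsingL hsingM hnotcls hcmem hcg honly hccvac hccvac' hA2 hLWcard hP₂1
            hP₂1' hP₃1
    · -- `|P₃| = 2`, `|L₀| = 1`: pattern (β) — two free points of `π₂` and a free spine point; two singletons
      exact deg_wit_case_p2_one_p3_two hd hk hs hfat hR₁2 hR₁3 hcop hnd₂ hdeg₃ hV hP hW hMset hP₃ hM' hL₀ hP₂ hAset hLset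
            hVg hPV hPind hP4 hMg hM3 hM2 ‹P₃.card ≤ 2› hMsplit hM'1 hy₃ hy₃side hL₀2 hπ₂3 hL₀P₂ hsplit hAW hL3 hLM
            hspineM hfreeL hfreeA hAoff hA3 hsingA hsingL hcmem hcg honly hccvac hccvac' hA2 hLWcard hP₂1 hP₂1' hP₃2
  · -- `|P₂| ≥ 2`: then `|L₀| ≤ 1`
    have hL₀1 : L₀.card ≤ 1 := by omega
    have hLWcard : Lset.card ≤ (Lset.filter (fun e => e ∈ W)).card + L₀.card := by
      have hsplitL : Lset.card = (Lset.filter (fun e => e ∈ W)).card + (Lset.filter (fun e => ¬ e ∈ W)).card :=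
        (Finset.card_filter_add_card_filter_not (s := Lset) _).symm
      have hsub : Lset.filter (fun e => ¬ e ∈ W) ⊆ L₀ := by
        intro e he
        rw [Finset.mem_filter] at he
        by_contra heL₀
        exact he.2 (hLW e he.1 heL₀)
      have := Finset.card_le_card hsub
      omega
    -- at most one spine point on a line through a basis point off the spine
    have hLline : ∀ c ∈ P₂, ∀ c' ∈ P, c ≠ c' → ∀ s ∈ Lset, ∀ s' ∈ Lset, s ≠ s' → s ∈ clF M {c, c'} →
        s' ∉ clF M {c, c'} := by
      intro c hc c' hc' hcc' s hsL s' hs'L hss' hsX hs'X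
      have hcg : c ∈ gr M := hVg (hPV (Finset.mem_filter.1 hc).1)
      have hc'g : c' ∈ gr M := hVg (hPV hc')
      have hsg : s ∈ gr M := hVg (Finset.mem_filter.1 hsL).1
      have hs'g : s' ∈ gr M := hVg (Finset.mem_filter.1 hs'L).1
      have hXg : ({c, c'} : Finset α) ⊆ gr M := Finset.insert_subset hcg (Finset.singleton_subset_iff.2 hc'g)
      have hsub : ({s, s'} : Finset α) ⊆ clF M ({c, c'} : Finset α) := by
        intro e he
        rw [Finset.mem_insert, Finset.mem_singleton] at he
        rcases he with rfl | rfl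
        · exact hsX
        · exact hs'X
      have hcl : clF M ({s, s'} : Finset α) = clF M ({c, c'} : Finset α) :=
        clF_eq_clF_of_subset_clF_of_rkN_le hXg hsub (by rw [hs c hcg c' hc'g hcc', hs s hsg s' hs'g hss'])
      have hsubL : ({s, s'} : Finset α) ⊆ clF M R₁ := by
        intro e he
        rw [Finset.mem_insert, Finset.mem_singleton] at he
        rcases he with rfl | rfl
        · exact (Finset.mem_filter.1 hsL).2
        · exact (Finset.mem_filter.1 hs'L).2
      have hcl2 : clF M ({s, s'} : Finset α) = clF M R₁ :=
        clF_eq_clF_of_subset_clF_of_rkN_le hR₁g hsubL (by rw [hR₁2, hs s hsg s' hs'g hss'])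
      have hcin : c ∈ clF M ({s, s'} : Finset α) := by
        rw [hcl]
        exact subset_clF_of_subset_gr hXg (Finset.mem_insert_self _ _)
      rw [hcl2] at hcin
      exact (Finset.mem_filter.1 hc).2.2 hcin
    rcases Nat.lt_or_ge P₂.card 3 with hP₂2' | hP₂3
    · -- `P₂ = {c, c'}`
      obtain ⟨c, c', hcc', hP₂eq⟩ := Finset.card_eq_two.1 (by omega : P₂.card = 2)
      have hcmem : c ∈ P₂ := by rw [hP₂eq]; exact Finset.mem_insert_self _ _
      have hc'mem : c' ∈ P₂ := by rw [hP₂eq]; exact Finset.mem_insert_of_mem (Finset.mem_singleton_self _)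
      have hcP : c ∈ P := (Finset.mem_filter.1 hcmem).1
      have hc'P : c' ∈ P := (Finset.mem_filter.1 hc'mem).1
      have hcg : c ∈ gr M := hVg (hPV hcP)
      have hc'g : c' ∈ gr M := hVg (hPV hc'P)
      have hmem : ∀ e ∈ P₂, e = c ∨ e = c' := fun e he => by
        rw [hP₂eq, Finset.mem_insert, Finset.mem_singleton] at he; exact he
      have hXg : ({c, c'} : Finset α) ⊆ gr M := Finset.insert_subset hcg (Finset.singleton_subset_iff.2 hc'g)
      have hX2 : rkN M ({c, c'} : Finset α) ≤ 2 := by rw [hs c hcg c' hc'g hcc']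
      -- the off–off pairs of `P₂` are `{c, c'}` (both orders)
      have hccpairs : ∀ (Q : Finset α → Prop), Q {c, c'} → ∀ d ∈ P₂, ∀ d' ∈ P₂, d ≠ d' → Q {d, d'} := by
        intro Q hQ d hd d' hd' hdd'
        rcases hmem d hd with rfl | rfl <;> rcases hmem d' hd' with rfl | rfl
        · exact absurd rfl hdd'
        · exact hQ
        · rw [Finset.pair_comm]; exact hQ
        · exact absurd rfl hdd'
      -- a free spine point: off `clF M`, and off `{c, c'}` unless the pair is harmless
      have hspinefree : ∀ s ∈ W, s ∈ clF M R₁ → s ∉ clF M Mset →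
          (s ∈ clF M {c, c'} → rkN M (insert w₀ (insert x {c, c'})) ≤ 3 → 4 ≤ rkN M ({c, c'} ∪ Mset)) →
          s ∉ clF M Mset ∧ ∀ a ∈ P, ∀ b ∈ P, a ≠ b → s ∈ clF M {a, b} → rkN M (insert w₀ (insert x {a, b})) ≤ 3 →
            4 ≤ rkN M ({a, b} ∪ Mset) := by
        intro s hsW hsL hsM hX
        apply hfreeL hL₀1 s hsW hsL hsM
        intro d hd d' hd' hdd' hsdd hcls
        rcases hmem d hd with rfl | rfl <;> rcases hmem d' hd' with rfl | rfl
        · exact absurd rfl hdd'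
        · exact hX hsdd hcls
        · rw [Finset.pair_comm] at hsdd hcls ⊢
          exact hX hsdd hcls
        · exact absurd rfl hdd'
      -- a spine point's singleton: unloaded when its `{c, c'}`-line (if through it) is a class line
      have hspinesing : ∀ s ∈ W, s ∈ clF M R₁ → s ∉ clF M Mset →
          (s ∈ clF M {c, c'} → rkN M (insert w₀ (insert x {c, c'})) ≤ 3) →
          ∀ a ∈ P, ∀ b ∈ P, a ≠ b → s ∈ clF M {a, b} → rkN M (insert w₀ (insert x {a, b})) ≤ 3 := by
        intro s hsW hsL hsM hX
        apply hsingL s hsW hsL hsM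
        intro d hd d' hd' hdd' hsdd
        rcases hmem d hd with rfl | rfl <;> rcases hmem d' hd' with rfl | rfl
        · exact absurd rfl hdd'
        · exact hX hsdd
        · rw [Finset.pair_comm] at hsdd ⊢
          exact hX hsdd
        · exact absurd rfl hdd'
      -- a point of `π₂` off the spine in `W` and off `clF {c, c'}`
      obtain ⟨f, hf, hfX⟩ := hAoff {c, c'} hX2
      have hfP₂ : f ∉ P₂ := by
        intro h
        rcases hmem f h with rfl | rfl
        · exact hfX (subset_clF_of_subset_gr hXg (Finset.mem_insert_self _ _))
        · exact hfX (subset_clF_of_subset_gr hXg (Finset.mem_insert_of_mem (Finset.mem_singleton_self _)))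
      have hfW : f ∈ W := hAW f hf hfP₂
      have hfL : f ∉ clF M R₁ := (Finset.mem_filter.1 hf).2.2
      -- `f` is free / on no non-class basis line as soon as the spine–off pairs through it are harmless
      have hffree_of : (∀ a ∈ L₀, ∀ d ∈ P₂, a ≠ d → f ∈ clF M {a, d} → rkN M (insert w₀ (insert x {a, d})) ≤ 3 →
          4 ≤ rkN M ({a, d} ∪ Mset)) →
          f ∉ clF M Mset ∧ ∀ a ∈ P, ∀ b ∈ P, a ≠ b → f ∈ clF M {a, b} → rkN M (insert w₀ (insert x {a, b})) ≤ 3 →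
            4 ≤ rkN M ({a, b} ∪ Mset) := by
        intro hac
        apply hfreeA f hf hfW hac
        intro d hd d' hd' hdd' hfdd
        exfalso
        rcases hmem d hd with rfl | rfl <;> rcases hmem d' hd' with rfl | rfl
        · exact hdd' rfl
        · exact hfX hfdd
        · rw [Finset.pair_comm] at hfdd; exact hfX hfdd
        · exact hdd' rfl
      have hfsing_of : (∀ a ∈ L₀, ∀ d ∈ P₂, a ≠ d → f ∈ clF M {a, d} → rkN M (insert w₀ (insert x {a, d})) ≤ 3) →
          ∀ a ∈ P, ∀ b ∈ P, a ≠ b → f ∈ clF M {a, b} → rkN M (insert w₀ (insert x {a, b})) ≤ 3 := by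
        intro hac
        apply hsingA f hf hfW hac
        intro d hd d' hd' hdd' hfdd
        exfalso
        rcases hmem d hd with rfl | rfl <;> rcases hmem d' hd' with rfl | rfl
        · exact hdd' rfl
        · exact hfX hfdd
        · rw [Finset.pair_comm] at hfdd; exact hfX hfdd
        · exact hdd' rfl
      rcases Nat.lt_or_ge L₀.card 1 with hL₀0 | hL₀1'
      · -- `L₀ = ∅`, `|P₃| = 2`: patterns (δ) / (β) according to the class property of `{c, c'}`
        exact deg_wit_case_p2_two_l0_empty hd hk hfat hR₁2 hR₁3 hcop hnd₂ hdeg₃ hV hP hW hMset hP₃ hM' hL₀ hP₂ hAset hLset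
              hP4 hM3 hM2 hP₃2 hMsplit hM'1 hy₃ hy₃side hL₀2 hπ₂3 hL₀P₂ hsplit hL3 hLW hLM hA3 hL₀1 hLWcard hLline
              hcc' hcmem hc'P hX2 hspinefree hspinesing hfW hfL hffree_of hfsing_of hP₂2 hP₂2' hL₀0
      · -- `L₀ = {a}`, `|P₃| = 1`: two side points
        exact deg_wit_case_p2_two_l0_one hd hk hs hfat hR₁2 hR₁3 hcop hcover hnd₂ hdeg₃ hV hP hW hMset hP₃ hM' hL₀ hP₂ hAset
              hLset hVg hPV hPW hP4 hR₁g hM3 hM2 hMne hP₃2 hMsplit hM'1 hy₃ hy₃side hL₀2 hπ₂3 hL₀P₂ hsplit hL3 hLM hAM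
              hpencil htwo hA3 hsingM hnotcls hL₀1 hLWcard hLline hcc' hcmem hc'mem hcP hc'P hmem hX2 hspinefree
              hspinesing hfW hfL hffree_of hP₂2 hP₂2' hL₀1'
    · -- `|P₂| = 3`: `L₀ = ∅`, `|P₃| = 1`: pattern (α) — two side points and a free spine point; `E = U`
      exact deg_wit_case_p2_three hd hk hfat hR₁2 hR₁3 hcop hcover hnd₂ hdeg₃ hV hP hW hMset hP₃ hM' hL₀ hP₂ hAset hLset
            hVg hPV hP4 hM3 hM2 hP₃2 hMsplit hM'1 hy₃ hy₃side hL₀2 hπ₂3 hL₀P₂ hsplit hL3 hLW hLM hAM hpencil htwo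
            hfreeL hA3 hsingM hL₀1 hLWcard hLline hP₂2 hP₂3

end PercRepro.Shadow
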